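import Summits.BirchSwinnertonDyer.BirchSwinnertonDyer.Theorems.KatoDescentPotSupersingularTowerTorsionOrdinaryLocal
import HarnessLib

/-!
# Imai's finiteness `W(ℚ_{p,∞})[p^∞] < ∞` IS A TREE THEOREM on the potentially ORDINARY rows too — hence at EVERY
# potentially good ODD prime (route-free helper for crux M = stmt-BirchSwinnertonDyer-19196 `ReducibleKatoMember`,
# K9 / K8-t′; seat `bsd-potss-rkm` g32; FILE 3 of 3)

WHY.  After seat g31 (p680430 / p680784 / p680827) crux M = `O6.KatoMemberShaBoundOfReducible` rests, in the kernel, on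
{modularity, `Kato2004.exists_memberHullZetaFineInputs`, H2X⁺ `Kato2004.exists_iwasawaH2Data_fineSelmerDual_embedding_count`,
Ferrero–Washington, Lim 2017 Thm. 3.5} ⊕ ONE local input on the potentially ORDINARY additive rows only: Imai's finiteness
`W(ℚ_{p,∞})[p^∞] < ∞` (the displayed schema `hImaiOrd` of `FineInputsImaiOrd.exists_memberHullZetaCoreInputs_of_fineInputs_of_imaiOrd`;
the named fact `imai1975_finite_fixedPoints_kerSubgroup_inf_decomp_of_padicValRat_j_nonneg`, p678243, recorded there as "the unit-root
line argument over the field of good reduction, not in the tree").  THIS FILE PROVES IT, for every odd `p`, with NO unit-root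
EIGENVALUE and NO weight argument — only the finiteness of `Ẽ_w(𝔽_{q^e})` and the Weil pairing:

* FILE 1 `KatoDescentPotSupersingularTowerTorsionOrdinaryBricks.lean` (§1–§3): Frobenius-power fixed points are finite; a
  `p`-divisible subgroup with finite image lies in the kernel; WEIL-PAIRING ANNIHILATORS (`σ` fixing `μ_{p^∞}` and a point `P` of
  order `p^n` moves `E[p^n]` inside `ℤ·P`);
* FILE 2 `KatoDescentPotSupersingularTowerTorsionOrdinaryLocal.lean` (§4–§5): the LOCAL ORDINARY LEMMA at a good ordinary place
  `w` of a number field `F` (the element `γ = ι·σ_w^e` fixing `μ_{p^∞}` — ramified cyclotomic lemma p683052 — kills every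
  `p`-primary `p`-divisible `N ≤ E(F̄)` it fixes: `f(N) ⊆ Ẽ_w(𝔽_{q^e})` finite ⇒ `N ≤ ker f`; Weil annihilators ⇒ `#f(E[p^n]) ≥ p^n`
  inside a finite set), and kmc g16's line-free reduction KEEPING «fixed by `D_𝔭 ⊓ ker κ`»;
* §6 `eq_bot_of_divisible_of_fixed_of_potentiallyOrdinary` — transport `ℚ̄ → F̄` (the tree's Serre-1967 template: move by `τ ∈ Γ_ℚ`,
  push along the equivariant injection `W(ℚ̄) → W_F(F̄)`), `γ|_{ℚ̄} ∈ ker κ` for the CYCLOTOMIC `κ`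
  (`mem_kerSubgroup_of_forall_smul_rootOfUnity_eq`: cyclotomic character `1`);
* §7 **`finite_fixedPoints_kerSubgroup_inf_decomp_of_potentiallyOrdinary`** — `W/ℚ`, `p` odd, good ORDINARY reduction at some
  place above `p` of some number field, `κ` cyclotomic, `v` the place at `p`:
  `Finite (FixedPoints.addSubgroup ↥(κ.kerSubgroup ⊓ GreenbergSelmer.decomp v) (W.geomPrimaryTorsion p))` — VERBATIM g31's
  `hImaiOrd` schema at odd `p`; and **`finite_fixedPoints_kerSubgroup_inf_decomp_of_padicValRat_j_nonneg`** — the Imai named fact's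
  conclusion for EVERY `W/ℚ`, EVERY ODD `p` with `0 ≤ ord_p j(W)` (potentially supersingular rows: p680430; potentially ordinary
  rows: §7).

HONEST FRAMING.  Theorems only (no definition, no named fact, no `sorry`); route-free (imports no `Theses.*`); closes nothing by
itself; BSD is proved for no curve.  What changes: the trust base of crux M (ALL its rows, `p` odd) and of 27962 loses Imai —
see the sibling `…ReducibleKatoMemberOfFineInputsNoImai.lean` (this seat).  The Imai NAMED FACT at `p = 2` is NOT discharged here
(the moved-`p`-torsion input (ii) uses `μ_p ⊄ ℚ_p`).

References: [Imai1975] Theorem (p. 12); [GreenbergLNM1716] §1 p. 62, §2 p. 70, §3 Lemma 3.3 (p. 87); [SerreInventiones1972] §1.11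
Prop. 11; [SilvermanAEC2009] Prop. III.8.1, Cor. III.6.4, VII.§2; [NeukirchANT1999] Ch. I §9, Ch. II (7.13), §9; tree:
`KatoDescentPotSupersingularTowerTorsionFinite.lean` (g31), `LocalTowerTorsionFiniteOfNoStableDivisibleLine.lean` /
`LocalTowerMovesPTorsionOfNoRootsOfUnity.lean` (kmc g16), `Serre1967/PotentiallySupersingularNoStableLineProofs.lean` (bsd-wall, the
transport template), `OrdinaryReductionFrobeniusHomProofs.lean` (the reduction map), `WeilPairingProofs.lean`,
`CyclotomicTowerLocalInertiaFiniteIndexProofs.lean` (this seat).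
-/

-- the summit and its single problem are both named `BirchSwinnertonDyer` (registry layout D-0017)
set_option linter.dupNamespace false
set_option autoImplicit false

noncomputable section

open scoped Classical NumberField AddSubgroup
open Function Field NumberField IsDedekindDomain WeierstrassCurve
open Literature.NumberTheory.EllipticCurves Literature.NumberTheory.EllipticCurves.GreenbergSelmer
open Literature.NumberTheory.GaloisRepresentations
open Summit.BirchSwinnertonDyer.BirchSwinnertonDyer.Theorems.SchneiderFreeAdditiveX3
open Summit.BirchSwinnertonDyer.BirchSwinnertonDyer.Theorems.SchneiderFreeControlAtoms

universe u

namespace Summit.BirchSwinnertonDyer.BirchSwinnertonDyer.Theorems.TowerTorsionFiniteOrdinary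

/-! ## §6 No FIXED stable divisible line at a potentially ORDINARY prime (transport `ℚ̄ → F̄`) -/

/-- **Membership in `ker κ` for the cyclotomic `ℤ_p`-extension from fixing `μ_{p^∞}`**: an element of `Γ_K` fixing every
`p`-power root of unity of `K̄` has cyclotomic character `1`, hence lies in `ker κ = χ_p⁻¹(μ(ℤ_p))`.
[cite: Washington1997, §13.1] -/
theorem mem_kerSubgroup_of_forall_smul_rootOfUnity_eq {K : Type u} [Field K] [NumberField K] {p : ℕ} [hp : Fact p.Prime]
    (κ : ZpExtension K p) (hκ : κ.IsCyclotomic) {σ : absoluteGaloisGroup K}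
    (hfix : ∀ (k : ℕ) (t : AlgebraicClosure K), t ^ p ^ k = 1 → σ • t = t) : σ ∈ κ.kerSubgroup := by
  have hpp := hp.out
  have hχ : GaloisRep.cyclotomicCharacter K p σ = 1 := by
    haveI : NeZero (p : K) := ⟨Nat.cast_ne_zero.mpr hpp.ne_zero⟩
    refine Units.ext (PadicInt.ext_of_toZModPow.mp fun k ↦ ?_)
    rw [Units.val_one, map_one]
    cases k with
    | zero =>
      haveI : Subsingleton (ZMod (p ^ 0)) := by rw [pow_zero]; infer_instance
      exact Subsingleton.elim _ _
    | succ k =>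
      haveI : NeZero ((p ^ (k + 1) : ℕ) : AlgebraicClosure K) :=
        ⟨by exact_mod_cast pow_ne_zero (k + 1) hpp.ne_zero⟩
      obtain ⟨t, ht⟩ := HasEnoughRootsOfUnity.exists_primitiveRoot (AlgebraicClosure K) (p ^ (k + 1))
      have hspec := GaloisRep.cyclotomicCharacter_spec K p (k := k + 1) σ t ht.pow_eq_one
      rw [hfix (k + 1) t ht.pow_eq_one] at hspec
      have hlt : 1 < p ^ (k + 1) := Nat.one_lt_pow (by omega) hpp.one_lt
      haveI : Fact (1 < p ^ (k + 1)) := ⟨hlt⟩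
      have hc := ht.pow_inj (ZMod.val_lt _) hlt (hspec.symm.trans (pow_one t).symm)
      exact ZMod.val_injective _ (hc.trans (ZMod.val_one _).symm)
  rw [show κ.kerSubgroup = _ from hκ, Subgroup.mem_comap, CommGroup.mem_torsion]
  change IsOfFinOrder (GaloisRep.cyclotomicCharacter K p σ)
  rw [hχ]
  exact IsOfFinOrder.one

/-- The prime of `ℤ` under a place `w ∋ p` of a number field is the place of `ℚ` at `p`. [folklore] -/
theorem under_eq_of_mem {F : Type} [Field F] [NumberField F] {p : ℕ} (hp : p.Prime) (w : HeightOneSpectrum (𝓞 F))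
    (hpw : (p : 𝓞 F) ∈ w.asIdeal) (v : HeightOneSpectrum (𝓞 ℚ)) (hpv : (p : 𝓞 ℚ) ∈ v.asIdeal) :
    w.asIdeal.under (𝓞 ℚ) = v.asIdeal := by
  have hprime : (w.asIdeal.under (𝓞 ℚ)).IsPrime := Ideal.IsPrime.under (𝓞 ℚ) w.asIdeal
  have hmem : (p : 𝓞 ℚ) ∈ w.asIdeal.under (𝓞 ℚ) := by
    rw [Ideal.under_def, Ideal.mem_comap, map_natCast]; exact hpw
  have hne : w.asIdeal.under (𝓞 ℚ) ≠ ⊥ := by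
    intro h0
    rw [h0, Ideal.mem_bot] at hmem
    exact hp.ne_zero (by exact_mod_cast hmem)
  let u : HeightOneSpectrum (𝓞 ℚ) := ⟨w.asIdeal.under (𝓞 ℚ), hprime, hne⟩
  have hu : u = Rat.HeightOneSpectrum.primesEquiv.symm ⟨p, hp⟩ :=
    (natCast_mem_asIdeal_iff_eq_primesEquiv_symm u hp).mp hmem
  have hv : v = Rat.HeightOneSpectrum.primesEquiv.symm ⟨p, hp⟩ :=
    (natCast_mem_asIdeal_iff_eq_primesEquiv_symm v hp).mp hpv
  have huv : u = v := hu.trans hv.symm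
  exact congrArg HeightOneSpectrum.asIdeal huv

/-- **No `p`-divisible subgroup of `W(ℚ̄)[p^∞]` is fixed pointwise by the local cyclotomic tower group `D_v ⊓ ker κ` at a
potentially ORDINARY `p`** (`W/ℚ` with good ORDINARY reduction at some place `w ∣ p` of some number field `F`; `κ` the
cyclotomic `ℤ_p`-extension of `ℚ`, `v` the place at `p`).  Transport (as in the tree's proof of Serre 1967 Prop. 8): move `N` by
`τ ∈ Γ_ℚ` so that the decomposition group of the prime of `ℤ̄` cut out by `F̄ → F̄_w` is carried into `D_v`, push it along the
`Γ_F`-equivariant injection `W(ℚ̄) → W_F(F̄)`; the image is `p`-divisible and fixed by the element `γ = ι·σ_w^e` of §4 (whose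
restriction to `ℚ̄` fixes `μ_{p^∞}`, hence lies in `ker κ`, `mem_kerSubgroup_of_forall_smul_rootOfUnity_eq`), so it is zero by
the local ordinary lemma. [cite: Imai1975, Theorem (p. 12)] [cite: GreenbergLNM1716, §2 p. 70 and §3 Lemma 3.3]
[cite: NeukirchANT1999, Ch. I §9 (9.1), (9.4)] -/
theorem eq_bot_of_divisible_of_fixed_of_potentiallyOrdinary (W : WeierstrassCurve ℚ) [W.IsElliptic] (p : ℕ)
    [hp : Fact p.Prime] {F : Type} [Field F] [NumberField F] (w : HeightOneSpectrum (𝓞 F))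
    (hpw : (p : 𝓞 F) ∈ w.asIdeal) (hgood : (W.baseChange F).HasGoodReductionAt w)
    (hunit : (W.baseChange F).HasUnitRootAt w) (κ : ZpExtension ℚ p) (hκ : κ.IsCyclotomic)
    (v : HeightOneSpectrum (𝓞 ℚ)) (hpv : (p : 𝓞 ℚ) ∈ v.asIdeal) (N : AddSubgroup (W.geomPrimaryTorsion p))
    (hNdiv : ∀ c ∈ N, ∃ c' ∈ N, p • c' = c) (hNfix : ∀ c ∈ N, ∀ g ∈ decomp v ⊓ κ.kerSubgroup, g • c = c) :
    N = ⊥ := by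
  have hpp : p.Prime := hp.out
  haveI : (W.baseChange F).IsElliptic := inferInstanceAs (W.map (algebraMap ℚ F)).IsElliptic
  -- the local ordinary lemma at `w`
  obtain ⟨γ, -, hγμ, hloc⟩ :=
    exists_fixing_rootsOfUnity_forall_eq_bot_of_hasUnitRootAt (W.baseChange F) p w hpw hgood hunit
  -- decomposition groups: `𝔔₀ = adicCompletionPrime F w`, `𝔓 ∣ v` below it, `τ • 𝔓₀ = 𝔓`
  have hw : w.asIdeal.under (𝓞 ℚ) = v.asIdeal := under_eq_of_mem hpp w hpw v hpv
  obtain ⟨𝔓, h𝔓, hD⟩ := exists_primesAbove_decompositionSubgroup_le_comap ℚ F hw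
    (adicCompletionPrime_mem_primesAbove (F : Type) w)
  obtain ⟨τ, hτ⟩ := HeightOneSpectrum.exists_smul_eq_of_mem_primesAbove_holds
    (adicCompletionPrime_mem_primesAbove ℚ v) h𝔓
  -- the embedding `ℚ̄ → F̄` and the restrictions
  let ι₁ : AlgebraicClosure ℚ →ₐ[ℚ] AlgebraicClosure F := closureEmb (K := ℚ) F
  have hres₁ : ∀ σ : absoluteGaloisGroup F, resGalOfEmb ι₁ σ = absGaloisRestrict ℚ F σ := fun σ => by
    rw [show ι₁ = closureEmb (K := ℚ) F from rfl, ← resGal_eq, WeierstrassCurve.resGal_eq_absGaloisRestrict]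
  have hres₂ : ∀ γ' : absoluteGaloisGroup (w.adicCompletion F),
      resGal (K := F) (w.adicCompletion F) γ' = absGaloisRestrict F (w.adicCompletion F) γ' := fun γ' => by
    rw [WeierstrassCurve.resGal_eq_absGaloisRestrict]
  -- `δ γ = (γ|_{F̄})|_{ℚ̄}` and `φ γ = τ⁻¹ δ τ ∈ D_v ⊓ ker κ`
  set ρ : absoluteGaloisGroup F := absGaloisRestrict F (w.adicCompletion F) γ with hρ
  set δ : absoluteGaloisGroup ℚ := resGalOfEmb ι₁ ρ with hδ
  have hδD : δ ∈ 𝔓.decompositionSubgroup (absoluteGaloisGroup ℚ) := by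
    have h2 : ρ ∈ (adicCompletionPrime (F : Type) w).decompositionSubgroup (absoluteGaloisGroup F) := by
      rw [hρ, decompositionSubgroup_adicCompletionPrime_eq_range]
      exact ⟨γ, rfl⟩
    have h1 := hD _ h2
    rwa [← hres₁] at h1
  have hφD : τ⁻¹ * δ * τ ∈ decomp v := by
    change τ⁻¹ * δ * τ ∈ (absGaloisRestrict ℚ (v.adicCompletion ℚ)).toMonoidHom.range
    rw [← decompositionSubgroup_adicCompletionPrime_eq_range]
    have h1 := hδD
    rw [← hτ, Ideal.decompositionSubgroup_smul, Subgroup.mem_pointwise_smul_iff_inv_smul_mem,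
      MulAut.smul_def, MulAut.conj_inv_apply] at h1
    exact h1
  have hδfix : ∀ (k : ℕ) (t : AlgebraicClosure ℚ), t ^ p ^ k = 1 → δ • t = t := by
    intro k t ht
    apply ι₁.toRingHom.injective
    have h1 : ι₁ (δ • t) = (show AlgebraicClosure F ≃ₐ[F] AlgebraicClosure F from ρ) (ι₁ t) := by
      rw [hδ]
      exact apply_resGalAuxOfEmb_apply ι₁ ρ t
    change ι₁ (δ • t) = ι₁ t
    rw [h1]
    exact hγμ k (ι₁ t) (by rw [← map_pow, ht, map_one])
  have hδker : δ ∈ κ.kerSubgroup := mem_kerSubgroup_of_forall_smul_rootOfUnity_eq κ hκ hδfix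
  have hφker : τ⁻¹ * δ * τ ∈ κ.kerSubgroup := by
    rw [ZpExtension.mem_kerSubgroup] at hδker ⊢
    rw [map_mul, map_mul, map_inv, hδker, mul_one, inv_mul_cancel]
  -- the transport map `g = ι₁_* ∘ (τ • ·)` on `W(ℚ̄)[p^∞]`
  let g : ↥(W.geomPrimaryTorsion p) →+ geomPoints (W.baseChange F) :=
    (geomPointsMapOfEmb W ι₁).comp
      ((DistribSMul.toAddMonoidHom (geomPoints W) τ).comp (W.geomPrimaryTorsion p).subtype)
  have hg : ∀ c, g c = geomPointsMapOfEmb W ι₁ (τ • (c : geomPoints W)) := fun c => rfl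
  have hg_inj : Function.Injective g := by
    intro a b hab
    rw [hg, hg] at hab
    exact Subtype.ext (MulAction.injective τ (geomPointsMapOfEmb_injective _ _ hab))
  have hφg : ∀ c, g ((τ⁻¹ * δ * τ) • c) = ρ • g c := by
    intro c
    rw [hg, hg, primaryComponent.coe_smul, smul_smul]
    have hmul : τ * (τ⁻¹ * δ * τ) = resGalOfEmb ι₁ ρ * τ := by
      change τ * (τ⁻¹ * δ * τ) = δ * τ
      group
    rw [hmul, mul_smul, geomPointsMapOfEmb_smul]
  -- hypotheses on `N₁ = g(N)`
  set N₁ : AddSubgroup (geomPoints (W.baseChange F)) := N.map g with hN₁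
  have hmem : ∀ {c' : geomPoints (W.baseChange F)}, c' ∈ N₁ ↔ ∃ c ∈ N, g c = c' := fun {c'} => by
    rw [hN₁, AddSubgroup.mem_map]
  have hprim : ∀ c' ∈ N₁, ∃ k : ℕ, p ^ k • c' = 0 := by
    intro c' hc'
    obtain ⟨c, -, rfl⟩ := hmem.mp hc'
    obtain ⟨k, hk⟩ := (AddCommGroup.mem_primaryComponent.mp c.2)
    refine ⟨k, ?_⟩
    have hk' : p ^ k • c = 0 := Subtype.ext (by rw [AddSubmonoidClass.coe_nsmul, hk]; rfl)
    rw [← map_nsmul, hk', map_zero]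
  have hdiv : ∀ c' ∈ N₁, ∃ c'' ∈ N₁, p • c'' = c' := by
    intro c' hc'
    obtain ⟨c, hc, rfl⟩ := hmem.mp hc'
    obtain ⟨c₁, hc₁, hpc₁⟩ := hNdiv c hc
    exact ⟨g c₁, hmem.mpr ⟨c₁, hc₁, rfl⟩, by rw [← map_nsmul, hpc₁]⟩
  have hfixN : ∀ c' ∈ N₁, ρ • c' = c' := by
    intro c' hc'
    obtain ⟨c, hc, rfl⟩ := hmem.mp hc'
    rw [← hφg, hNfix c hc _ (Subgroup.mem_inf.mpr ⟨hφD, hφker⟩)]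
  have hN₁bot : N₁ = ⊥ := hloc N₁ hprim hdiv hfixN
  rw [eq_bot_iff]
  intro c hc
  have : g c ∈ N₁ := hmem.mpr ⟨c, hc, rfl⟩
  rw [hN₁bot, AddSubgroup.mem_bot] at this
  rw [AddSubgroup.mem_bot]
  exact hg_inj (by rw [this, map_zero])

/-! ## §7 Imai's finiteness on the potentially ORDINARY rows, and at every potentially good ODD prime -/

/-- **Imai's finiteness `W(ℚ_{p,∞})[p^∞] < ∞` at a potentially ORDINARY odd prime — the displayed `hImaiOrd` schema of crux M's
closers (p680827) as a KERNEL THEOREM for odd `p`.**  For an elliptic curve `W/ℚ`, an odd prime `p` at which `W` acquires good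
ORDINARY reduction at some place `w ∣ p` of some number field, the cyclotomic `ℤ_p`-extension `κ` of `ℚ` and the place `v` of
`ℚ` at `p`, the points of `W(ℚ̄)[p^∞]` fixed by `ker κ ⊓ D_v` form a FINITE group — VERBATIM the conclusion of the Imai fact
`imai1975_finite_fixedPoints_kerSubgroup_inf_decomp_of_padicValRat_j_nonneg` and the hypothesis `hfin` of H2X / H2X⁺ on these
rows.  Proof: the line-free reduction of §5 with (i′) = §6 and (ii) = kmc's moved `p`-torsion point (`μ_p ⊄ ℚ_p`, `p` odd).
[cite: Imai1975, Theorem (p. 12)] [cite: GreenbergLNM1716, §1 p. 62, §2 p. 70, §3 Lemma 3.3 (p. 87)]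
[cite: SerreInventiones1972, §1.11 Prop. 11] -/
theorem finite_fixedPoints_kerSubgroup_inf_decomp_of_potentiallyOrdinary (W : WeierstrassCurve ℚ) [W.IsElliptic]
    (p : ℕ) [Fact p.Prime] (hp2 : p ≠ 2)
    (hpo : ∃ (F : Type) (_ : Field F) (_ : NumberField F) (w : HeightOneSpectrum (𝓞 F)),
      ((p : ℕ) : 𝓞 F) ∈ w.asIdeal ∧ (W.baseChange F).HasGoodReductionAt w ∧ (W.baseChange F).HasUnitRootAt w)
    (κ : ZpExtension ℚ p) (hκ : κ.IsCyclotomic) (v : HeightOneSpectrum (𝓞 ℚ))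
    (hv : ((Rat.HeightOneSpectrum.primesEquiv v : Nat.Primes) : ℕ) = p) :
    Finite (FixedPoints.addSubgroup ↥(κ.kerSubgroup ⊓ decomp v) (W.geomPrimaryTorsion p)) := by
  have hpr : p.Prime := Fact.out
  have hpv : ((p : ℕ) : 𝓞 ℚ) ∈ v.asIdeal :=
    (natCast_mem_asIdeal_iff_eq_primesEquiv_symm v hpr).mpr
      ((Equiv.eq_symm_apply _).mpr (Subtype.ext hv))
  obtain ⟨F, _, _, w, hpw, hgood, hunit⟩ := hpo
  have hfin := W.localTowerTorsionFiniteAt_of_noFixedStableDivisibleLine p κ v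
    (fun N _ hNdiv _ hNfix ↦
      eq_bot_of_divisible_of_fixed_of_potentiallyOrdinary W p w hpw hgood hunit κ hκ v hpv N hNdiv hNfix)
    (TowerTorsionFinite.exists_pTorsion_not_fixed_rat W p hp2 κ v hv)
  unfold LocalTowerTorsionFiniteAt at hfin
  rw [inf_comm]
  exact hfin.to_subtype

/-- **Imai's finiteness at EVERY potentially good ODD prime** (`0 ≤ ord_p j(W)`, `κ` cyclotomic, `v` the place at `p`): the
potentially SUPERSINGULAR rows are the tree theorem of the prequel
(`TowerTorsionFinite.finite_fixedPoints_kerSubgroup_inf_decomp_of_potentiallySupersingular`, Serre 1967 Prop. 8), the potentially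
ORDINARY rows are §7's theorem.  This is the Imai named fact `imai1975_finite_fixedPoints_kerSubgroup_inf_decomp_of_padicValRat_j_nonneg`
RESTRICTED TO ODD `p` — the only parity crux M and the H2X⁺ consumers ever use. [cite: Imai1975, Theorem (p. 12)]
[cite: Serre1967GroupesPDivisibles, §5 Prop. 8] [cite: GreenbergLNM1716, §3 Lemma 3.3 (p. 87)] -/
theorem finite_fixedPoints_kerSubgroup_inf_decomp_of_padicValRat_j_nonneg (W : WeierstrassCurve ℚ) [W.IsElliptic]
    (p : ℕ) [Fact p.Prime] (hp2 : p ≠ 2) (hj : 0 ≤ padicValRat p W.j)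
    (κ : ZpExtension ℚ p) (hκ : κ.IsCyclotomic) (v : HeightOneSpectrum (𝓞 ℚ))
    (hv : ((Rat.HeightOneSpectrum.primesEquiv v : Nat.Primes) : ℕ) = p) :
    Finite (FixedPoints.addSubgroup ↥(κ.kerSubgroup ⊓ decomp v) (W.geomPrimaryTorsion p)) := by
  by_cases hss : ∀ (F : Type) [Field F] [NumberField F] (w : HeightOneSpectrum (𝓞 F)),
      ((p : ℕ) : 𝓞 F) ∈ w.asIdeal → (W.baseChange F).HasGoodReductionAt w → ¬ (W.baseChange F).HasUnitRootAt w
  · exact TowerTorsionFinite.finite_fixedPoints_kerSubgroup_inf_decomp_of_potentiallySupersingular W p hp2 hj hss κ v hv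
  · push Not at hss
    obtain ⟨F, _, _, w, hw, hgoodw, hunit⟩ := hss
    exact finite_fixedPoints_kerSubgroup_inf_decomp_of_potentiallyOrdinary W p hp2
      ⟨F, inferInstance, inferInstance, w, hw, hgoodw, hunit⟩ κ hκ v hv
end Summit.BirchSwinnertonDyer.BirchSwinnertonDyer.Theorems.TowerTorsionFiniteOrdinary

end
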